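import Mathlib
import HarnessLib
import Literature.NumberTheory.EllipticCurves.PastenCongruenceModulusSizeProofs

/-!
# Crux `ReceptacleIdentity` (stmt-ABC-1813), line `Sketch` — stub `stub_evalWindow`

The evaluation window of the Hasse-window mechanism: for a monic `q ∈ ℤ[X]` all of whose
complex roots have norm `≤ B` (`0 ≤ B`) and an integer `x` with `|x| > B`,

* (i) `q(x) ≠ 0` — otherwise `x ∈ ℂ` would be a root of `q` of norm `|x| > B`;
* (ii) `|q(x)| ≤ (|x| + B)^{deg q}` — the shifted polynomial `s = q(X + x) ∈ ℤ[X]` is monic of the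
  same degree, `s(0) = q(x)`, and its complex roots are the `μ - x` with `q(μ) = 0`, of norm
  `≤ |x| + B`; over `ℂ` the monic `s` is `∏ᵢ (X - νᵢ)`, so `|s(0)| = ∏ᵢ |νᵢ| ≤ (|x| + B)^{deg s}`
  (the tree lemma `abs_coeff_zero_le_pow_of_roots_le` of
  `Literature/NumberTheory/EllipticCurves/PastenCongruenceModulusSizeProofs.lean`, whose
  `heckeCongruenceModulus_le_pow_finrank_of_ringHom` performs the same shift).
-/

-- `Summit.ABC.ABC` is the mandated summit-side namespace (single-conjunct summit).
set_option linter.dupNamespace false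

open Polynomial
open Literature.NumberTheory.EllipticCurves.ModularForms

namespace Summit.ABC.ABC.Theorems.ReceptacleIdentitySketch

/-- **The evaluation window.**  Let `q ∈ ℤ[X]` be monic with every complex root of norm `≤ B`
(`0 ≤ B`), and let `x ∈ ℤ` with `|x| > B`.  Then `q(x) ≠ 0` (else `x`, cast to `ℂ`, is a root of
norm `|x| > B`) and `|q(x)| ≤ (|x| + B)^{deg q}` (the monic shift `s = q(X + x)` has `s(0) = q(x)`,
degree `deg q`, and complex roots `μ - x`, `q(μ) = 0`, of norm `≤ |x| + B`, so
`|s(0)| = ∏ |roots| ≤ (|x| + B)^{deg q}`).  Registered stub of line `Sketch` for crux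
stmt-ABC-1813. -/
theorem stub_evalWindow {q : ℤ[X]} (hq : q.Monic) {B : ℝ} (hB : 0 ≤ B)
    (hroot : ∀ μ : ℂ, (q.map (Int.castRingHom ℂ)).IsRoot μ → ‖μ‖ ≤ B) {x : ℤ}
    (hx : B < |(x : ℝ)|) :
    q.eval x ≠ 0 ∧ |((q.eval x : ℤ) : ℝ)| ≤ (|(x : ℝ)| + B) ^ q.natDegree := by
  refine ⟨fun h0 ↦ ?_, ?_⟩
  · -- (i) `x` would be a complex root of `q`, of norm `|x| > B`
    have hr : (q.map (Int.castRingHom ℂ)).IsRoot (x : ℂ) := by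
      rw [Polynomial.IsRoot.def, Polynomial.eval_map, ← eq_intCast (Int.castRingHom ℂ) x,
        Polynomial.eval₂_hom, h0, map_zero]
    have h := hroot _ hr
    rw [Complex.norm_intCast] at h
    exact absurd hx (not_lt.mpr h)
  · -- (ii) shift: `s = q(X + x)` is monic of degree `deg q`, `s(0) = q(x)`, roots `μ - x`
    -- adapted from Literature/NumberTheory/EllipticCurves/PastenCongruenceModulusSizeProofs.lean
    -- (`heckeCongruenceModulus_le_pow_finrank_of_ringHom`, step (5))
    set s : ℤ[X] := q.comp (X + C x) with hs
    have hsm : s.Monic := hq.comp_X_add_C x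
    have hdeg : s.natDegree = q.natDegree := by
      rw [hs, Polynomial.natDegree_comp, Polynomial.natDegree_X_add_C, mul_one]
    have hcoeff : s.coeff 0 = q.eval x := by
      rw [Polynomial.coeff_zero_eq_eval_zero, hs, Polynomial.eval_comp, Polynomial.eval_add,
        Polynomial.eval_X, Polynomial.eval_C, zero_add]
    have hroots : ∀ μ : ℂ, (s.map (Int.castRingHom ℂ)).IsRoot μ → ‖μ‖ ≤ |(x : ℝ)| + B := by
      intro μ hμ
      rw [hs, Polynomial.IsRoot, Polynomial.map_comp, Polynomial.eval_comp, Polynomial.map_add,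
        Polynomial.map_X, Polynomial.map_C, Polynomial.eval_add, Polynomial.eval_X,
        Polynomial.eval_C, eq_intCast] at hμ
      have hB' := hroot (μ + x) hμ
      calc ‖μ‖ = ‖(μ + x) - x‖ := by rw [add_sub_cancel_right]
        _ ≤ ‖μ + x‖ + ‖(x : ℂ)‖ := norm_sub_le _ _
        _ ≤ B + |(x : ℝ)| := by rw [Complex.norm_intCast]; gcongr
        _ = |(x : ℝ)| + B := add_comm _ _
    have hle := abs_coeff_zero_le_pow_of_roots_le hsm (by positivity) hroots
    rwa [hcoeff, hdeg] at hle

end Summit.ABC.ABC.Theorems.ReceptacleIdentitySketch
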